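import Literature.AlgebraicGeometry.Resolution.AlterationsNormalFormBlowup
import Literature.AlgebraicGeometry.Resolution.BlowupRegularPoints
import Literature.AlgebraicGeometry.Resolution.BlowupsFlatBaseChange
import HarnessLib

/-!
# De Jong's alteration theorem: Claim 4.27 in its two printed parts, the count proved

Topic: `Literature/AlgebraicGeometry/Resolution`. Companion to `AlterationsNormalFormBlowup.lean`,
which vendors de Jong 1996, 4.26–4.27 as ONE named fact `DeJong1996NormalFormPairBlowup`: for
a pair `(X, Z)` in Situation 4.25 (`DeJong1996.NormalFormPair f Z d`), an irreducible component
`E` of `Sing(X)` and a blow-up `π : X' → X` of `X` in the ideal sheaf of `E` with `X'`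
projective, `(X', π⁻¹(Z))` is again in Situation 4.25 and `Sing(X')` has one irreducible
component less. The printed proof of Claim 4.27 makes two separate claims, by two separate
arguments, and this file vendors them separately and PROVES everything else:

> "Again the proof is a nice exercise in blowing up: Since `E` is smooth, its ideal in the rings
> of (ii) is given by `(u, v, t₁, t₂)` after renumbering. [C1] Before we give some computations,
> let us describe the singular locus of `X'`. Let `E' ⊂ X` be another irreducible component of
> the singular locus of `X`. Let `Ẽ' ⊂ X'` be the strict transform of `E'`. This equals the
> blowing up of `E'` in the nonsingular closed subscheme `E' ∩ E` (scheme-theoretically), hence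
> `Ẽ'` is nonsingular. Then `Sing(X')` is the union of the `Ẽ'` so obtained. [C2] We blow up the
> scheme `Spec k⟦u, v, t₁, …, t_{d-1}⟧/(uv - t₁ ⋯ t_s)` in the ideal `(u, v, t₁, t₂)`. We get four
> charts (…) Chart "`u ≠ 0`" (…) Clearly, this is smooth and `Z` is given by
> `u t₁' t₂' t₃ ⋯ t_r = 0`, a normal crossings divisor. Chart "`t₁ ≠ 0`" (…) The divisor `Z'` is
> given by `t₁ t₂' t₃ ⋯ t_r = 0`. Clearly the singularities are of the type described in (ii)."
> (pp. 75–76)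

* `DeJong1996NormalFormPairBlowupSingularLocus` — NAMED FACT [C1]: `Sing(X')` is the union of
  the strict transforms `Ẽ'` (the closure of `π⁻¹(E' ∖ E)`) of the components `E' ≠ E` of
  `Sing(X)`, and each `Ẽ'`, with its reduced structure, is a regular scheme.
* `DeJong1996NormalFormPairBlowupCharts` — NAMED FACT [C2], the chart computation: `π⁻¹(Z)` is
  the support of an effective Cartier divisor, and the formal conditions 4.25 (i), (ii) hold
  for `(X', π⁻¹(Z))` at the closed points.
* `DeJong1996NormalFormPairBlowupSingularLocusOverCentre` — NAMED FACT [C1 over `E`]: the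
  part of [C1] that needs the charts, namely [C1] at the points of `X'` over the centre `E`;
  PROVED `DeJong1996NormalFormPairBlowupSingularLocus.of_overCentre`: [C1] follows, since off
  `π⁻¹(E)` the blow-up is a local isomorphism (`mem_regularLocus_iff_of_isIso_morphismRestrict`,
  `BlowupsFlatBaseChange.lean`), so that there `Sing(X') = π⁻¹(Sing(X) ∖ E)`, which is covered
  by the `π⁻¹(E' ∖ E) ⊆ Ẽ'` and lies over the `E' ⊆ Sing(X)`.
* PROVED: the **irreducible components of a subset** `S ⊆ X` as subsets of `X`
  (`componentsIn S`, the images of the irreducible components of the subspace `S`), their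
  characterisation as the maximal irreducible subsets of `S` (`mem_componentsIn_iff`), the
  components of a finite union of pairwise incomparable irreducible closed sets
  (`componentsIn_sUnion_eq`); **strict transforms** of closed subsets under a morphism which is
  an isomorphism off a closed set `C` (`strictTransformSet`), and the count
  `ncard_componentsIn_of_eq_biUnion_strictTransformSet`: if the closed `S'` upstairs is the
  union of the strict transforms of the components `E' ≠ E` of the closed `S` downstairs and `π`
  is an isomorphism over `X ∖ E`, then these strict transforms ARE the components of `S'`
  (they are irreducible, closed and pairwise incomparable) and `#S' + 1 = #S` on components;
  for the blow-up of 4.26 (`IsBlowup.isIso_morphismRestrict`: an isomorphism off the centre)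
  this is "The number of components of `Sing(X')` is one less than the number of components of
  `Sing(X)`"; together with the variety conditions of `X'` (`IsBlowup.isIntegral`; `dim X' = d`
  by `IsAlteration.topologicalKrullDim_eq`; `Sing(X')` closed over the perfect `k`) this gives
  the assembly `DeJong1996NormalFormPairBlowup.of_singularLocus_of_charts` of the target fact
  from C1 and C2, whence `DeJong1996CodimThreeModification` and
  `DeJong1996NormalFormPairResolution` from the leaves now live.

## Sources

* A. J. de Jong, *Smoothness, semi-stability and alterations*, Publ. Math. IHÉS 83 (1996) 51–93:
  2.18 (p. 60), 4.25–4.27 (pp. 75–76).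
* U. Görtz, T. Wedhorn, *Algebraic Geometry I*, 2nd ed. (2020), (13.19) p. 414 (strict
  transform of a closed subscheme), Prop. 13.91 (3) (a blow-up is an isomorphism off its
  centre), via `Blowups.lean`.
* H. Matsumura, *Commutative Ring Theory* (1986), §30 Cor. to Thm. 30.5 (the regular locus of a
  variety over a perfect field is open), via `BlowupRegularPoints.lean`.
-/

noncomputable section

open CategoryTheory CategoryTheory.Limits AlgebraicGeometry TopologicalSpace Topology

namespace Literature.AlgebraicGeometry.Resolution

universe u

open IsLocalRing

/-! ## Irreducible components of a subset -/

section Topology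

variable {X : Type u} [TopologicalSpace X] {S : Set X}

/-- The **irreducible components of a subset** `S` of a topological space `X`, as subsets of
`X`: the images of the irreducible components of the subspace `S` (de Jong 1996, 2.2: "an
irreducible component … will often be considered as a reduced closed subscheme"; the facts of
`AlterationsNormalFormBlowup.lean` quantify over `irreducibleComponents ↥S` and use the images,
cf. `ncard_componentsIn_eq`). [folklore] -/
def componentsIn (S : Set X) : Set (Set X) :=
  (fun T : Set S => ((↑) : S → X) '' T) '' irreducibleComponents S

namespace componentsIn

/-- The image of an irreducible component of the subspace is a component. [folklore] -/
theorem image_val_mem {T : Set S} (hT : T ∈ irreducibleComponents S) :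
    ((↑) : S → X) '' T ∈ componentsIn S :=
  ⟨T, hT, rfl⟩

/-- An irreducible component of `S` is contained in `S`. [folklore] -/
theorem subset {E : Set X} (hE : E ∈ componentsIn S) : E ⊆ S := by
  obtain ⟨T, -, rfl⟩ := hE
  rintro _ ⟨x, -, rfl⟩
  exact x.2

/-- An irreducible component of `S` is irreducible (in `X`). [folklore] -/
theorem isIrreducible {E : Set X} (hE : E ∈ componentsIn S) : IsIrreducible E := by
  obtain ⟨T, hT, rfl⟩ := hE
  exact hT.1.image _ continuous_subtype_val.continuousOn

/-- An irreducible component of `S` is non-empty. [folklore] -/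
theorem nonempty {E : Set X} (hE : E ∈ componentsIn S) : E.Nonempty :=
  (isIrreducible hE).nonempty

/-- An irreducible component of a closed subset is closed. [folklore] -/
theorem isClosed (hS : IsClosed S) {E : Set X} (hE : E ∈ componentsIn S) : IsClosed E := by
  obtain ⟨T, hT, rfl⟩ := hE
  exact hS.isClosedEmbedding_subtypeVal.isClosedMap _ (isClosed_of_mem_irreducibleComponents _ hT)

/-- A subset of a Noetherian space has finitely many irreducible components. [folklore] -/
theorem finite [NoetherianSpace X] (S : Set X) : (componentsIn S).Finite :=
  (NoetherianSpace.finite_irreducibleComponents (α := S)).image _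

/-- Every point of `S` lies on an irreducible component of `S`. [folklore] -/
theorem exists_mem {x : X} (hx : x ∈ S) : ∃ E ∈ componentsIn S, x ∈ E :=
  ⟨_, ⟨irreducibleComponent (⟨x, hx⟩ : S), irreducibleComponent_mem_irreducibleComponents _, rfl⟩,
    ⟨⟨x, hx⟩, mem_irreducibleComponent, rfl⟩⟩

end componentsIn

/-- The images of distinct subsets of the subspace are distinct: counting the components of
`S` in `X` or in the subspace gives the same number. [folklore] -/
theorem ncard_componentsIn_eq (S : Set X) :
    (componentsIn S).ncard = (irreducibleComponents S).ncard :=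
  ((Set.image_injective.mpr Subtype.val_injective).injOn).ncard_image

/-- For a closed `S`, the image of an irreducible component of the subspace `S` is closed, so
it is its own closure (the form in which `AlterationsNormalFormBlowup.lean` names the centre
of 4.26). [folklore] -/
theorem closure_image_val_eq (hS : IsClosed S) {T : Set S} (hT : T ∈ irreducibleComponents S) :
    closure (((↑) : S → X) '' T) = ((↑) : S → X) '' T :=
  (componentsIn.isClosed hS (componentsIn.image_val_mem hT)).closure_eq

/-- Irreducibility of a subset of the subspace `S` can be tested in `X`. [folklore] -/
theorem isPreirreducible_of_image_val {T : Set S}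
    (h : IsPreirreducible (((↑) : S → X) '' T)) : IsPreirreducible T := by
  intro u v hu hv hTu hTv
  obtain ⟨u', hu', rfl⟩ := isOpen_induced_iff.mp hu
  obtain ⟨v', hv', rfl⟩ := isOpen_induced_iff.mp hv
  obtain ⟨x, hxu⟩ := hTu
  obtain ⟨y, hyv⟩ := hTv
  obtain ⟨_, ⟨z, hzT, rfl⟩, hzu, hzv⟩ :=
    h u' v' hu' hv' ⟨x, ⟨x, hxu.1, rfl⟩, hxu.2⟩ ⟨y, ⟨y, hyv.1, rfl⟩, hyv.2⟩
  exact ⟨z, hzT, hzu, hzv⟩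

/-- Irreducibility of a subset of the subspace `S` is irreducibility in `X`. [folklore] -/
theorem isIrreducible_image_val_iff {T : Set S} :
    IsIrreducible (((↑) : S → X) '' T) ↔ IsIrreducible T :=
  ⟨fun h => ⟨by simpa using h.nonempty, isPreirreducible_of_image_val h.isPreirreducible⟩,
    fun h => h.image _ continuous_subtype_val.continuousOn⟩

/-- **The irreducible components of `S` are its maximal irreducible subsets.** [folklore] -/
theorem mem_componentsIn_iff {E : Set X} :
    E ∈ componentsIn S ↔
      E ⊆ S ∧ IsIrreducible E ∧ ∀ T : Set X, T ⊆ S → IsIrreducible T → E ⊆ T → T ⊆ E := by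
  constructor
  · intro hE
    refine ⟨componentsIn.subset hE, componentsIn.isIrreducible hE, fun T hTS hT hET => ?_⟩
    obtain ⟨T₀, hT₀, rfl⟩ := hE
    let T' : Set S := ((↑) : S → X) ⁻¹' T
    have hT' : ((↑) : S → X) '' T' = T := by
      rw [Set.image_preimage_eq_inter_range, Subtype.range_coe]
      exact Set.inter_eq_left.mpr hTS
    have hirr : IsIrreducible T' := isIrreducible_image_val_iff.mp (hT' ▸ hT)
    have hle : T₀ ⊆ T' := fun x hx => hET ⟨x, hx, rfl⟩
    have := hT₀.2 hirr hle
    rw [← hT']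
    exact Set.image_mono this
  · rintro ⟨hES, hE, hmax⟩
    let E' : Set S := ((↑) : S → X) ⁻¹' E
    have hE' : ((↑) : S → X) '' E' = E := by
      rw [Set.image_preimage_eq_inter_range, Subtype.range_coe]
      exact Set.inter_eq_left.mpr hES
    refine ⟨E', ⟨isIrreducible_image_val_iff.mp (hE' ▸ hE), fun T hT hle => ?_⟩, hE'⟩
    have h1 : E ⊆ ((↑) : S → X) '' T := by
      rw [← hE']
      exact Set.image_mono hle
    have h2 := hmax _ (by rintro _ ⟨x, -, rfl⟩; exact x.2) (isIrreducible_image_val_iff.mpr hT) h1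
    intro x hx
    have : (x : X) ∈ E := h2 ⟨x, hx, rfl⟩
    exact this

/-- **The irreducible components of a finite union of pairwise incomparable irreducible closed
sets are those sets.** [folklore] -/
theorem componentsIn_sUnion_eq {𝒯 : Set (Set X)} (h𝒯 : 𝒯.Finite)
    (hirr : ∀ T ∈ 𝒯, IsIrreducible T) (hcl : ∀ T ∈ 𝒯, IsClosed T)
    (hinc : ∀ T ∈ 𝒯, ∀ T' ∈ 𝒯, T ⊆ T' → T = T') : componentsIn (⋃₀ 𝒯) = 𝒯 := by
  -- an irreducible subset of the union lies in a member
  have key : ∀ A : Set X, IsIrreducible A → A ⊆ ⋃₀ 𝒯 → ∃ T ∈ 𝒯, A ⊆ T := by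
    intro A hA hAU
    obtain ⟨T, hT, hAT⟩ :=
      isIrreducible_iff_sUnion_isClosed.mp hA h𝒯.toFinset (fun T hT => hcl T (by simpa using hT))
        (by simpa using hAU)
    exact ⟨T, by simpa using hT, hAT⟩
  ext E
  rw [mem_componentsIn_iff]
  constructor
  · rintro ⟨hEU, hE, hmax⟩
    obtain ⟨T, hT, hET⟩ := key E hE hEU
    have hTE : T ⊆ E := hmax T (Set.subset_sUnion_of_mem hT) (hirr T hT) hET
    rwa [Set.Subset.antisymm hET hTE]
  · intro hE
    refine ⟨Set.subset_sUnion_of_mem hE, hirr E hE, fun T hTU hT hET => ?_⟩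
    obtain ⟨T', hT', hTT'⟩ := key T hT hTU
    have := hinc E hE T' hT' (hET.trans hTT')
    subst this
    exact hTT'

/-- Distinct irreducible components are incomparable: a component not equal to `E` is not
contained in `E`. [folklore] -/
theorem not_subset_of_mem_componentsIn_of_ne {E E' : Set X} (hE : E ∈ componentsIn S)
    (hE' : E' ∈ componentsIn S) (hne : E' ≠ E) : ¬ E' ⊆ E := by
  intro hle
  have h1 := ((mem_componentsIn_iff.mp hE').2.2 E (componentsIn.subset hE)
    (componentsIn.isIrreducible hE) hle)
  exact hne (Set.Subset.antisymm hle h1)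

/-- A component `E' ≠ E` is the closure of `E' ∖ E` (for `E` closed). [folklore] -/
theorem subset_closure_diff_of_mem_componentsIn {E : Set X} (hEc : IsClosed E) {E' : Set X}
    (hE : E ∈ componentsIn S) (hE' : E' ∈ componentsIn S) (hne : E' ≠ E) :
    E' ⊆ closure (E' \ E) := by
  have hne' : (E' ∩ Eᶜ).Nonempty := by
    by_contra h
    rw [Set.not_nonempty_iff_eq_empty, ← Set.sdiff_eq, Set.sdiff_eq_empty] at h
    exact not_subset_of_mem_componentsIn_of_ne hE hE' hne h
  have := subset_closure_inter_of_isPreirreducible_of_isOpen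
    (componentsIn.isIrreducible hE').isPreirreducible hEc.isOpen_compl hne'
  rwa [← Set.sdiff_eq] at this

/-- The trace of a preirreducible set on an open set is preirreducible. [folklore] -/
theorem isPreirreducible_inter_of_isOpen {t O : Set X} (ht : IsPreirreducible t)
    (hO : IsOpen O) : IsPreirreducible (t ∩ O) := by
  rintro u v hu hv ⟨x, ⟨hxt, hxO⟩, hxu⟩ ⟨y, ⟨hyt, hyO⟩, hyv⟩
  obtain ⟨z, hzt, ⟨hzu, hzO⟩, hzv, -⟩ :=
    ht (u ∩ O) (v ∩ O) (hu.inter hO) (hv.inter hO) ⟨x, hxt, hxu, hxO⟩ ⟨y, hyt, hyv, hyO⟩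
  exact ⟨z, ⟨hzt, hzO⟩, hzu, hzv⟩

end Topology

/-! ## Strict transforms of closed subsets (de Jong 1996, 2.18, 4.27; Görtz–Wedhorn (13.19)) -/

/-- The **strict transform** of the subset `T ⊆ X` under `π : X' → X` with respect to the closed
subset `C ⊆ X` (the centre; `π` is an isomorphism over `X ∖ C` in all uses): the closure of
`π⁻¹(T ∖ C)` in `X'` (Görtz–Wedhorn I, (13.19) p. 414; de Jong 1996, 4.27: "Let `Ẽ' ⊂ X'` be
the strict transform of `E'`"; cf. the iterated `CentreSeq.strictTransform` of
`BlowupSequences.lean`). [cite: GortzWedhorn2020, (13.19) p. 414] -/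
def strictTransformSet {X' X : Scheme.{u}} (π : X' ⟶ X) (C T : Set X) : Set X' :=
  closure (π ⁻¹' (T \ C))

namespace strictTransformSet

variable {X' X : Scheme.{u}} (π : X' ⟶ X) (C T : Set X)

/-- A strict transform is closed. [folklore] -/
theorem isClosed : IsClosed (strictTransformSet π C T) :=
  isClosed_closure

/-- `π⁻¹(T ∖ C)` lies in the strict transform of `T`. [folklore] -/
theorem preimage_diff_subset : π ⁻¹' (T \ C) ⊆ strictTransformSet π C T :=
  subset_closure

/-- The strict transform of a closed `T` lies over `T`. [folklore] -/
theorem subset_preimage {T : Set X} (hT : IsClosed T) : strictTransformSet π C T ⊆ π ⁻¹' T :=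
  closure_minimal (Set.preimage_mono Set.sdiff_subset) (hT.preimage π.continuous)

/-- The image of the strict transform of a closed `T` lies in `T`. [folklore] -/
theorem image_subset {T : Set X} (hT : IsClosed T) : π '' strictTransformSet π C T ⊆ T :=
  Set.image_subset_iff.mpr (subset_preimage π C hT)

end strictTransformSet

/-! ## Morphisms which are isomorphisms over an open -/

section IsoOver

variable {X' X : Scheme.{u}} (π : X' ⟶ X) (U : X.Opens) [IsIso (π ∣_ U)]

/-- If `π` is an isomorphism over the open `U`, every point of `U` is in the image. [folklore] -/
theorem exists_apply_eq_of_isIso_morphismRestrict {y : X} (hy : y ∈ U) : ∃ x : X', π x = y := by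
  let g := (π ∣_ U).homeomorph
  refine ⟨(π ⁻¹ᵁ U).ι (g.symm ⟨y, hy⟩), ?_⟩
  have h1 : π ((π ⁻¹ᵁ U).ι (g.symm ⟨y, hy⟩)) = U.ι ((π ∣_ U) (g.symm ⟨y, hy⟩)) := by
    rw [← Scheme.Hom.comp_apply, ← Scheme.Hom.comp_apply, morphismRestrict_ι]
  rw [h1]
  change U.ι (g (g.symm ⟨y, hy⟩)) = y
  rw [g.apply_symm_apply]
  rfl

/-- If `π` is an isomorphism over the open `U`, the preimage of a subset `A ⊆ U` is the image in
`X'` of its preimage under the homeomorphism `π⁻¹(U) ≅ U`. [folklore] -/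
theorem preimage_eq_image_ι_of_isIso_morphismRestrict {A : Set X} (hAU : A ⊆ (U : Set X)) :
    π ⁻¹' A = (π ⁻¹ᵁ U).ι '' ((π ∣_ U).homeomorph ⁻¹' (U.ι ⁻¹' A)) := by
  ext x'
  constructor
  · intro hx'
    have hxV : x' ∈ (π ⁻¹ᵁ U) := hAU hx'
    refine ⟨⟨x', hxV⟩, ?_, rfl⟩
    change U.ι ((π ∣_ U) ⟨x', hxV⟩) ∈ A
    rw [Scheme.Opens.ι_apply, morphismRestrict_base_coe]
    exact hx'
  · rintro ⟨z, hz, rfl⟩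
    change U.ι ((π ∣_ U) z) ∈ A at hz
    rw [Scheme.Opens.ι_apply, morphismRestrict_base_coe] at hz
    exact hz

/-- If `π` is an isomorphism over the open `U`, the preimage of an irreducible `A ⊆ U` is
irreducible. [folklore] -/
theorem isIrreducible_preimage_of_isIso_morphismRestrict {A : Set X} (hA : IsIrreducible A)
    (hAU : A ⊆ (U : Set X)) : IsIrreducible (π ⁻¹' A) := by
  rw [preimage_eq_image_ι_of_isIso_morphismRestrict π U hAU]
  refine IsIrreducible.image ?_ _ (π ⁻¹ᵁ U).ι.continuous.continuousOn
  have h1 : IsIrreducible (U.ι ⁻¹' A) := by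
    refine hA.preimage U.ι.isOpenEmbedding ?_
    obtain ⟨a, ha⟩ := hA.nonempty
    exact ⟨a, ha, by rw [Scheme.Opens.range_ι]; exact hAU ha⟩
  rw [← Homeomorph.image_symm]
  exact h1.image _ (π ∣_ U).homeomorph.symm.continuous.continuousOn

end IsoOver

/-! ## Counting components through strict transforms -/

section Components

variable {X' X : Scheme.{u}} (π : X' ⟶ X) {S : Set X} {E : Set X}

/-- Under a morphism which is an isomorphism off the closed `E`, the strict transform of an
irreducible component `E' ≠ E` of `S ∋ E` is irreducible. [folklore] -/
theorem isIrreducible_strictTransformSet (hEc : IsClosed E)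
    [IsIso (π ∣_ ⟨Eᶜ, hEc.isOpen_compl⟩)] {E' : Set X} (hE : E ∈ componentsIn S)
    (hE' : E' ∈ componentsIn S) (hne : E' ≠ E) : IsIrreducible (strictTransformSet π E E') := by
  refine IsIrreducible.closure ?_
  refine isIrreducible_preimage_of_isIso_morphismRestrict π ⟨Eᶜ, hEc.isOpen_compl⟩ ?_
    (Set.sdiff_subset_compl E' E)
  -- `E' ∖ E` is a non-empty relatively open subset of the irreducible `E'`
  have hne' : (E' \ E).Nonempty := by
    by_contra h
    rw [Set.not_nonempty_iff_eq_empty, Set.sdiff_eq_empty] at h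
    exact not_subset_of_mem_componentsIn_of_ne hE hE' hne h
  rw [Set.sdiff_eq]
  exact ⟨Set.sdiff_eq (s := E') (t := E) ▸ hne',
    isPreirreducible_inter_of_isOpen (componentsIn.isIrreducible hE').isPreirreducible
      hEc.isOpen_compl⟩

/-- Under a morphism which is an isomorphism off the closed `E`, a set `E'` is recovered from
its strict transform up to `E`: `E' ∖ E ⊆ π(Ẽ')`. [folklore] -/
theorem diff_subset_image_strictTransformSet (hEc : IsClosed E)
    [IsIso (π ∣_ ⟨Eᶜ, hEc.isOpen_compl⟩)] (E' : Set X) :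
    E' \ E ⊆ π '' strictTransformSet π E E' := by
  intro y hy
  obtain ⟨x, hx⟩ := exists_apply_eq_of_isIso_morphismRestrict π ⟨Eᶜ, hEc.isOpen_compl⟩ hy.2
  refine ⟨x, strictTransformSet.preimage_diff_subset π E E' ?_, hx⟩
  rw [Set.mem_preimage, hx]
  exact hy

/-- Under a morphism which is an isomorphism off the closed `E`, the strict transforms of the
components `E' ≠ E` of the closed set `S ∋ E` are pairwise incomparable. [folklore] -/
theorem eq_of_strictTransformSet_subset (hS : IsClosed S) (hEc : IsClosed E)
    [IsIso (π ∣_ ⟨Eᶜ, hEc.isOpen_compl⟩)] (hE : E ∈ componentsIn S) {E₁ E₂ : Set X}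
    (hE₁ : E₁ ∈ componentsIn S) (hE₂ : E₂ ∈ componentsIn S) (hne₁ : E₁ ≠ E)
    (h : strictTransformSet π E E₁ ⊆ strictTransformSet π E E₂) : E₁ = E₂ := by
  have h2c : IsClosed E₂ := componentsIn.isClosed hS hE₂
  -- `E₁ ∖ E ⊆ π(Ẽ₁) ⊆ π(Ẽ₂) ⊆ E₂`, so `E₁ ⊆ closure (E₁ ∖ E) ⊆ E₂`
  have h1 : E₁ \ E ⊆ E₂ :=
    (diff_subset_image_strictTransformSet π hEc E₁).trans
      ((Set.image_mono h).trans (strictTransformSet.image_subset π E h2c))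
  have h12 : E₁ ⊆ E₂ :=
    (subset_closure_diff_of_mem_componentsIn hEc hE hE₁ hne₁).trans (closure_minimal h1 h2c)
  exact Set.Subset.antisymm h12 ((mem_componentsIn_iff.mp hE₁).2.2 E₂
    (componentsIn.subset hE₂) (componentsIn.isIrreducible hE₂) h12)

/-- **Counting components through strict transforms.** Let `S ⊆ X` be closed with finitely many
irreducible components, `E` one of them, `π : X' → X` an isomorphism over `X ∖ E`, and suppose
the set `S' ⊆ X'` is the union of the strict transforms of the components `E' ≠ E` of `S`.
Then the components of `S'` are exactly these strict transforms (they are irreducible, closed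
and pairwise incomparable, `componentsIn_sUnion_eq`), and there is one less of them than of
components of `S`. [folklore] -/
theorem ncard_componentsIn_of_eq_biUnion_strictTransformSet (hS : IsClosed S)
    (hfin : (componentsIn S).Finite) (hE : E ∈ componentsIn S)
    [IsIso (π ∣_ ⟨Eᶜ, (componentsIn.isClosed hS hE).isOpen_compl⟩)] {S' : Set X'}
    (hS' : S' = ⋃ E' ∈ componentsIn S \ {E}, strictTransformSet π E E') :
    componentsIn S' = strictTransformSet π E '' (componentsIn S \ {E}) ∧
      (componentsIn S').ncard + 1 = (componentsIn S).ncard := by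
  have hEc : IsClosed E := componentsIn.isClosed hS hE
  have hinj : Set.InjOn (strictTransformSet π E) (componentsIn S \ {E}) := by
    intro E₁ hE₁ E₂ hE₂ h
    exact eq_of_strictTransformSet_subset π hS hEc hE hE₁.1 hE₂.1 hE₁.2 h.le
  have hcomp : componentsIn S' = strictTransformSet π E '' (componentsIn S \ {E}) := by
    rw [hS', ← Set.sUnion_image]
    refine componentsIn_sUnion_eq (hfin.sdiff.image _) ?_ ?_ ?_
    · rintro _ ⟨E', hE', rfl⟩
      exact isIrreducible_strictTransformSet π hEc hE hE'.1 hE'.2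
    · rintro _ ⟨E', -, rfl⟩
      exact strictTransformSet.isClosed π E E'
    · rintro _ ⟨E₁, hE₁, rfl⟩ _ ⟨E₂, hE₂, rfl⟩ h
      rw [eq_of_strictTransformSet_subset π hS hEc hE hE₁.1 hE₂.1 hE₁.2 h]
  refine ⟨hcomp, ?_⟩
  rw [hcomp, hinj.ncard_image, Set.ncard_sdiff_singleton_of_mem hE, Nat.sub_add_cancel]
  exact (Set.ncard_pos hfin).mpr ⟨E, hE⟩

end Components

/-! ## Claim 4.27 in its two printed parts, as named facts -/

/-- NAMED FACT — **de Jong 1996, 4.27 [C1]: the singular locus of the blow-up.** In the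
setting of 4.26 as rendered in `DeJong1996NormalFormPairBlowup` (`AlterationsNormalFormBlowup.lean`:
a pair `(X, Z)` in Situation 4.25, `DeJong1996.NormalFormPair f Z d`, over an algebraically
closed `k`; an irreducible component `E` of the singular locus `Sing(X) = {x | 𝒪_{X,x} not
regular}` — a subset of the subspace, with closed image `Ē ⊆ X`; a blow-up `π : X' → X` of `X`
in the ideal sheaf of `Ē`; `X'` projective): "Before we give some computations, let us
describe the singular locus of `X'`. Let `E' ⊂ X` be another irreducible component of the
singular locus of `X`. Let `Ẽ' ⊂ X'` be the strict transform of `E'`. This equals the blowing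
up of `E'` in the nonsingular closed subscheme `E' ∩ E` (scheme-theoretically), hence `Ẽ'` is
nonsingular. Then `Sing(X')` is the union of the `Ẽ'` so obtained." Rendered: `Sing(X')` is the
union, over the irreducible components `E' ≠ Ē` of `Sing(X)` (`componentsIn`), of the strict
transforms `Ẽ' = closure of π⁻¹(E' ∖ Ē)` (`strictTransformSet π Ē E'`), and each such `Ẽ'`,
with its reduced closed subscheme structure (`vanishingIdeal`, `IdealSheafData.subscheme`), is
a regular scheme (the printed reason — `Ẽ' ≅ Bl_{E' ∩ E}(E')`, an integral scheme, so the
reduced structure on its support — is not rendered separately). Users take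
`(h : DeJong1996NormalFormPairBlowupSingularLocus)`; it is a node to decompose further.
[cite: DeJong1996, 4.27, p. 75] -/
def DeJong1996NormalFormPairBlowupSingularLocus : Prop :=
  ∀ (k : Type u) [Field k] [IsAlgClosed k] (X : Scheme.{u}) (f : X ⟶ Spec (.of k)) (Z : Set X)
    (d : ℕ), DeJong1996.NormalFormPair f Z d →
      ∀ E ∈ irreducibleComponents
          ↥({x : X | ¬ IsRegularLocalRing (X.presheaf.stalk x)} : Set X),
        ∀ (X' : Scheme.{u}) (π : X' ⟶ X),
          IsBlowup π (Scheme.IdealSheafData.vanishingIdeal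
            ⟨closure (Subtype.val '' E), isClosed_closure⟩) →
            Literature.AlgebraicGeometry.Motives.IsProjectiveOver (Over.mk (π ≫ f)) →
            ({x : X' | ¬ IsRegularLocalRing (X'.presheaf.stalk x)} : Set X') =
                ⋃ E' ∈ componentsIn ({x : X | ¬ IsRegularLocalRing (X.presheaf.stalk x)} : Set X) \
                    {closure (Subtype.val '' E)},
                  strictTransformSet π (closure (Subtype.val '' E)) E' ∧
              ∀ E' ∈ componentsIn ({x : X | ¬ IsRegularLocalRing (X.presheaf.stalk x)} : Set X),
                E' ≠ closure (Subtype.val '' E) →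
                  Scheme.IsRegular (Scheme.IdealSheafData.vanishingIdeal
                    ⟨strictTransformSet π (closure (Subtype.val '' E)) E',
                      strictTransformSet.isClosed π _ E'⟩).subscheme

/-- NAMED FACT — **de Jong 1996, 4.27 [C2]: the chart computation.** In the setting of 4.26 (as
in `DeJong1996NormalFormPairBlowupSingularLocus`), with `Z' = π⁻¹(Z)`: "We blow up the scheme
`Spec k⟦u, v, t₁, …, t_{d-1}⟧/(uv - t₁ ⋯ t_s)` in the ideal `(u, v, t₁, t₂)`. We get four charts
associated to the coordinates `u, v, t₁, t₂`. By symmetry, we need only deal with two of these.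
Chart "`u ≠ 0`". Here we have coordinates `u, v, t₁, …, t_{d-1}, v', t₁', t₂'` and equations
`v = uv'`, `t₁ = ut₁'`, `t₂ = ut₂'` and `v' - t₁'t₂'t₃ ⋯ t_s = 0`. Clearly, this is smooth and
`Z` is given by `u t₁' t₂' t₃ ⋯ t_r = 0`, a normal crossings divisor. Chart "`t₁ ≠ 0`". Here we
have coordinates `u, v, t₁, …, t_{d-1}, u', v', t₂'` and equations `u = t₁u'`, `v = t₁v'`,
`t₂ = t₁t₂'` and `u'v' - t₂' t₃ ⋯ t_s = 0`. The divisor `Z'` is given by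
`t₁ t₂' t₃ ⋯ t_r = 0`. Clearly the singularities are of the type described in (ii)." — the
local clauses of "The pair `(X', Z')` is as described in 4.25", in the formal-local rendering
of `DeJong1996.NormalFormPair`: `Z'` is the support of an effective Cartier divisor
(`IsEffectiveCartier`); at every nonsingular closed point of `Z'`,
`(𝒪̂_{X',x'}, Î_{Z'}) ≅ (k⟦x₁, …, x_d⟧, (x₁ ⋯ x_r))`, `1 ≤ r ≤ d`; at every singular closed
point, `(𝒪̂_{X',x'}, Î_{Z'}) ≅ (k⟦u, v, t₁, …, t_{d-1}⟧/(uv - t₁ ⋯ t_s), (t₁ ⋯ t_r))`,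
`2 ≤ s ≤ r ≤ d - 1` (`completedStalkIdeal` of the vanishing ideal sheaf of `Z'`,
`NodalFamilyRing`, `nodalFamilyBoundary`, `normalCrossingsEquation`). Users take
`(h : DeJong1996NormalFormPairBlowupCharts)`; it is a node to decompose further (blow-ups
commute with completion; the two chart algebras). [cite: DeJong1996, 4.27, p. 76] -/
def DeJong1996NormalFormPairBlowupCharts : Prop :=
  ∀ (k : Type u) [Field k] [IsAlgClosed k] (X : Scheme.{u}) (f : X ⟶ Spec (.of k)) (Z : Set X)
    (d : ℕ) (h : DeJong1996.NormalFormPair f Z d),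
      ∀ E ∈ irreducibleComponents
          ↥({x : X | ¬ IsRegularLocalRing (X.presheaf.stalk x)} : Set X),
        ∀ (X' : Scheme.{u}) (π : X' ⟶ X),
          IsBlowup π (Scheme.IdealSheafData.vanishingIdeal
            ⟨closure (Subtype.val '' E), isClosed_closure⟩) →
            Literature.AlgebraicGeometry.Motives.IsProjectiveOver (Over.mk (π ≫ f)) →
            (∃ I : X'.IdealSheafData, IsEffectiveCartier I ∧ (I.support : Set X') = π ⁻¹' Z) ∧
              (∀ x : X', IsClosed ({x} : Set X') → IsRegularLocalRing (X'.presheaf.stalk x) →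
                x ∈ π ⁻¹' Z →
                  ∃ r : ℕ, 1 ≤ r ∧ r ≤ d ∧
                    ∃ e : AdicCompletion (maximalIdeal (X'.presheaf.stalk x))
                        (X'.presheaf.stalk x) ≃+* MvPowerSeries (Fin d) k,
                      ∀ (U : X'.affineOpens) (hU : x ∈ (U : X'.Opens)),
                        (completedStalkIdeal (Scheme.IdealSheafData.vanishingIdeal
                            ⟨π ⁻¹' Z, h.isClosed.preimage π.continuous⟩) x U hU).map
                          e.toRingHom =
                          Ideal.span {DeJong1996.normalCrossingsEquation k d r}) ∧
              ∀ x : X', IsClosed ({x} : Set X') → ¬ IsRegularLocalRing (X'.presheaf.stalk x) →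
                ∃ s r : ℕ, 2 ≤ s ∧ s ≤ r ∧ r ≤ d - 1 ∧
                  ∃ e : AdicCompletion (maximalIdeal (X'.presheaf.stalk x))
                      (X'.presheaf.stalk x) ≃+* DeJong1996.NodalFamilyRing k (d - 1) s,
                    ∀ (U : X'.affineOpens) (hU : x ∈ (U : X'.Opens)),
                      (completedStalkIdeal (Scheme.IdealSheafData.vanishingIdeal
                          ⟨π ⁻¹' Z, h.isClosed.preimage π.continuous⟩) x U hU).map
                        e.toRingHom =
                        Ideal.span {DeJong1996.nodalFamilyBoundary k (d - 1) s r}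

/-! ## The rest of Claim 4.27, proved -/

namespace DeJong1996.NormalFormPair

variable {k : Type u} [Field k] {X X' : Scheme.{u}} {f : X ⟶ Spec (.of k)} {Z : Set X} {d : ℕ}
  {π : X' ⟶ X}

/-- **The singular locus of a scheme of finite type over a perfect field is closed** (Matsumura,
Cor. to Thm. 30.5, `isOpen_regularLocus_of_locallyOfFiniteType_perfectField`); in 4.27 for the
blow-up `X'`, of finite type over `k` since `π` is proper.
[cite: Matsumura1987, §30 Cor. to Thm. 30.5] -/
theorem isClosed_setOf_not_isRegularLocalRing_of_locallyOfFiniteType [PerfectField k]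
    (g : X' ⟶ Spec (.of k)) [LocallyOfFiniteType g] :
    IsClosed ({x : X' | ¬ IsRegularLocalRing (X'.presheaf.stalk x)} : Set X') := by
  have e : ({x : X' | ¬ IsRegularLocalRing (X'.presheaf.stalk x)} : Set X') =
      (Scheme.regularLocus X')ᶜ := rfl
  rw [e]
  exact (isOpen_regularLocus_of_locallyOfFiniteType_perfectField g).isClosed_compl

/-- In 4.26, `π` is an isomorphism over the complement of the centre `Ē` (a blow-up is an
isomorphism off its centre, `IsBlowup.isIso_morphismRestrict`).
[cite: DeJong1996, 4.26–4.27, p. 75] -/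
theorem isIso_morphismRestrict_compl_of_isBlowup (C : Closeds X)
    (hπ : IsBlowup π (Scheme.IdealSheafData.vanishingIdeal C)) :
    IsIso (π ∣_ ⟨(C : Set X)ᶜ, C.isClosed.isOpen_compl⟩) :=
  hπ.isIso_morphismRestrict (by simpa using disjoint_compl_left)

/-- In 4.26, `dim X' = dim X = d`: a blow-up in a non-zero ideal sheaf is a modification, in
particular an alteration, of the variety `X` (`IsAlteration.topologicalKrullDim_eq`).
[cite: DeJong1996, 2.20 and 4.26, pp. 61, 75] -/
theorem topologicalKrullDim_eq_of_isBlowup (h : NormalFormPair f Z d) {J : X.IdealSheafData}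
    (hJ : J ≠ ⊥) (hπ : IsBlowup π J) : topologicalKrullDim X' = d := by
  haveI := h.isIntegral
  haveI := h.locallyOfFiniteType
  haveI : IsLocallyNoetherian X := LocallyOfFiniteType.isLocallyNoetherian f
  rw [← h.topologicalKrullDim_eq]
  exact (IsModification.of_isBlowup hπ hJ).isAlteration.topologicalKrullDim_eq f

end DeJong1996.NormalFormPair

/-! ## [C1] over the centre, and [C1] from it -/

/-- NAMED FACT — **de Jong 1996, 4.27 [C1] at the points over the centre.** In the setting of
4.26 (as in `DeJong1996NormalFormPairBlowupSingularLocus`, of which this is the part over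
`π⁻¹(Ē)` — the only part that needs the chart computation, see
`DeJong1996NormalFormPairBlowupSingularLocus.of_overCentre`): "Let `E' ⊂ X` be another
irreducible component of the singular locus of `X`. Let `Ẽ' ⊂ X'` be the strict transform of
`E'`. (…) hence `Ẽ'` is nonsingular. Then `Sing(X')` is the union of the `Ẽ'` so obtained" —
rendered at the points `x'` of `X'` with `π(x') ∈ Ē`: such a point is singular on `X'` iff it
lies on the strict transform `Ẽ'` of some component `E' ≠ Ē` of `Sing(X)`; and each such `Ẽ'`,
with its reduced closed subscheme structure, is a regular scheme. (In the chart "`t₁ ≠ 0`" of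
p. 76: "The irreducible component `u' = v' = t₂' = t₃ = 0` of the singular locus maps onto
`u = v = t₂ = t₃ = 0`, the component `u' = v' = t₃ = t₄ = 0` is the strict transform of the
component `u = v = t₃ = t₄ = 0`.") Users take
`(h : DeJong1996NormalFormPairBlowupSingularLocusOverCentre)`; it is a node to decompose
further (the charts). [cite: DeJong1996, 4.27, pp. 75–76] -/
def DeJong1996NormalFormPairBlowupSingularLocusOverCentre : Prop :=
  ∀ (k : Type u) [Field k] [IsAlgClosed k] (X : Scheme.{u}) (f : X ⟶ Spec (.of k)) (Z : Set X)
    (d : ℕ), DeJong1996.NormalFormPair f Z d →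
      ∀ E ∈ irreducibleComponents
          ↥({x : X | ¬ IsRegularLocalRing (X.presheaf.stalk x)} : Set X),
        ∀ (X' : Scheme.{u}) (π : X' ⟶ X),
          IsBlowup π (Scheme.IdealSheafData.vanishingIdeal
            ⟨closure (Subtype.val '' E), isClosed_closure⟩) →
            Literature.AlgebraicGeometry.Motives.IsProjectiveOver (Over.mk (π ≫ f)) →
            (∀ x' : X', π x' ∈ closure (Subtype.val '' E) →
                (¬ IsRegularLocalRing (X'.presheaf.stalk x') ↔
                  ∃ E' ∈ componentsIn ({x : X | ¬ IsRegularLocalRing (X.presheaf.stalk x)} : Set X),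
                    E' ≠ closure (Subtype.val '' E) ∧
                      x' ∈ strictTransformSet π (closure (Subtype.val '' E)) E')) ∧
              ∀ E' ∈ componentsIn ({x : X | ¬ IsRegularLocalRing (X.presheaf.stalk x)} : Set X),
                E' ≠ closure (Subtype.val '' E) →
                  Scheme.IsRegular (Scheme.IdealSheafData.vanishingIdeal
                    ⟨strictTransformSet π (closure (Subtype.val '' E)) E',
                      strictTransformSet.isClosed π _ E'⟩).subscheme

/-- **[C1] from its part over the centre**: off `π⁻¹(Ē)` the blow-up `π` is a local
isomorphism (`IsBlowup.isIso_morphismRestrict`, `mem_regularLocus_iff_of_isIso_morphismRestrict`),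
so a point `x'` with `π(x') ∉ Ē` is singular on `X'` iff `π(x')` is singular on `X`, iff
`π(x')` lies on a component `E'` of `Sing(X)` — necessarily `E' ≠ Ē` — iff `x'` lies on some
`Ẽ' ⊇ π⁻¹(E' ∖ Ē)` (the `Ẽ'` lie over the closed `E' ⊆ Sing(X)`). [cite: DeJong1996, 4.27, p. 75] -/
theorem DeJong1996NormalFormPairBlowupSingularLocus.of_overCentre
    (H : DeJong1996NormalFormPairBlowupSingularLocusOverCentre.{u}) :
    DeJong1996NormalFormPairBlowupSingularLocus.{u} := by
  intro k _ _ X f Z d h E hE X' π hπ hproj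
  obtain ⟨hover, hreg⟩ := H k X f Z d h E hE X' π hπ hproj
  refine ⟨?_, hreg⟩
  have hS : IsClosed ({x : X | ¬ IsRegularLocalRing (X.presheaf.stalk x)} : Set X) :=
    h.isClosed_setOf_not_isRegularLocalRing
  have hE₀eq : closure (Subtype.val '' E) = Subtype.val '' E := closure_image_val_eq hS hE
  have hCmem : closure (Subtype.val '' E) ∈
      componentsIn ({x : X | ¬ IsRegularLocalRing (X.presheaf.stalk x)} : Set X) := by
    rw [hE₀eq]
    exact componentsIn.image_val_mem hE
  haveI : IsIso (π ∣_ ⟨(closure (Subtype.val '' E))ᶜ, isClosed_closure.isOpen_compl⟩) :=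
    DeJong1996.NormalFormPair.isIso_morphismRestrict_compl_of_isBlowup
      ⟨closure (Subtype.val '' E), isClosed_closure⟩ hπ
  ext x'
  simp only [Set.mem_setOf_eq, Set.mem_iUnion, Set.mem_sdiff, Set.mem_singleton_iff, exists_prop]
  by_cases hx : π x' ∈ closure (Subtype.val '' E)
  · rw [hover x' hx]
    exact ⟨fun ⟨E', hE', hne, hx'⟩ => ⟨E', ⟨hE', hne⟩, hx'⟩,
      fun ⟨E', ⟨hE', hne⟩, hx'⟩ => ⟨E', hE', hne, hx'⟩⟩
  · -- off the centre: local rings agree with those of `X`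
    have hiff := mem_regularLocus_iff_of_isIso_morphismRestrict π
      ⟨(closure (Subtype.val '' E))ᶜ, isClosed_closure.isOpen_compl⟩ x' hx
    simp only [Scheme.mem_regularLocus] at hiff
    constructor
    · intro hx'
      have hπx : ¬ IsRegularLocalRing (X.presheaf.stalk (π x')) := fun hr => hx' (hiff.mpr hr)
      obtain ⟨E', hE', hxE'⟩ := componentsIn.exists_mem
        (S := ({x : X | ¬ IsRegularLocalRing (X.presheaf.stalk x)} : Set X)) hπx
      have hne : E' ≠ closure (Subtype.val '' E) := by
        rintro rfl
        exact hx hxE'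
      exact ⟨E', ⟨hE', hne⟩, strictTransformSet.preimage_diff_subset π _ E' ⟨hxE', hx⟩⟩
    · rintro ⟨E', ⟨hE', -⟩, hx'⟩ hreg'
      have hπx : π x' ∈ E' :=
        strictTransformSet.subset_preimage π _ (componentsIn.isClosed hS hE') hx'
      exact componentsIn.subset hE' hπx (hiff.mp hreg')

/-! ## The assembly -/

/-- **`DeJong1996NormalFormPairBlowup` (Claim 4.27) from its two printed parts** — the
description of `Sing(X')` [C1] (`DeJong1996NormalFormPairBlowupSingularLocus`) and the chart
computation [C2] (`DeJong1996NormalFormPairBlowupCharts`) — the remaining clauses of "the pair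
`(X', Z')` is as described in 4.25" and the count being proved: `X'` is integral
(`IsBlowup.isIntegral`) of dimension `d` (`topologicalKrullDim_eq_of_isBlowup`), `π⁻¹(Z)` and
`Sing(X')` are closed (the latter over the perfect `k`), and — `π` being an isomorphism off the
centre — the irreducible components of `Sing(X')` are the strict transforms `Ẽ'`, `E' ≠ Ē`,
nonsingular by [C1], one less in number than the components of `Sing(X)`
(`ncard_componentsIn_of_eq_biUnion_strictTransformSet`). [cite: DeJong1996, 4.26–4.27, pp. 75–76] -/
theorem DeJong1996NormalFormPairBlowup.of_singularLocus_of_charts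
    (hC₁ : DeJong1996NormalFormPairBlowupSingularLocus.{u})
    (hC₂ : DeJong1996NormalFormPairBlowupCharts.{u}) : DeJong1996NormalFormPairBlowup.{u} := by
  intro k _ _ X f Z d h E hE X' π hπ hproj
  have hS : IsClosed ({x : X | ¬ IsRegularLocalRing (X.presheaf.stalk x)} : Set X) :=
    h.isClosed_setOf_not_isRegularLocalRing
  -- the centre `Ē = closure E = E` is a component of `Sing(X)` in `X`
  have hE₀eq : closure (Subtype.val '' E) = Subtype.val '' E := closure_image_val_eq hS hE
  have hCmem : closure (Subtype.val '' E) ∈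
      componentsIn ({x : X | ¬ IsRegularLocalRing (X.presheaf.stalk x)} : Set X) := by
    rw [hE₀eq]
    exact componentsIn.image_val_mem hE
  obtain ⟨hsing, hregE⟩ := hC₁ k X f Z d h E hE X' π hπ hproj
  obtain ⟨hdiv, hi, hii⟩ := hC₂ k X f Z d h E hE X' π hπ hproj
  haveI := h.isIntegral
  haveI := h.locallyOfFiniteType
  haveI : IsNoetherian X := h.isNoetherian
  have hJ := h.vanishingIdeal_ne_bot E
  haveI : IsIntegral X' := hπ.isIntegral hJ
  haveI : IsProper π := hπ.isProper
  haveI : IsIso (π ∣_ ⟨(closure (Subtype.val '' E))ᶜ,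
      (componentsIn.isClosed hS hCmem).isOpen_compl⟩) :=
    DeJong1996.NormalFormPair.isIso_morphismRestrict_compl_of_isBlowup
      ⟨closure (Subtype.val '' E), isClosed_closure⟩ hπ
  -- the count, and the components of `Sing(X')`
  obtain ⟨hcomp, hcount⟩ := ncard_componentsIn_of_eq_biUnion_strictTransformSet π hS
    (componentsIn.finite _) hCmem hsing
  have hS'c : IsClosed ({x : X' | ¬ IsRegularLocalRing (X'.presheaf.stalk x)} : Set X') :=
    DeJong1996.NormalFormPair.isClosed_setOf_not_isRegularLocalRing_of_locallyOfFiniteType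
      (π ≫ f)
  refine ⟨⟨inferInstance, hproj, h.topologicalKrullDim_eq_of_isBlowup hJ hπ,
    h.isClosed.preimage π.continuous, hdiv, hi, hii, hS'c, fun E' hE' => ?_⟩, ?_⟩
  · -- a component of `Sing(X')` is a strict transform `Ẽ''`, `E'' ≠ Ē`, hence nonsingular
    have hmem : Subtype.val '' E' ∈
        componentsIn ({x : X' | ¬ IsRegularLocalRing (X'.presheaf.stalk x)} : Set X') :=
      componentsIn.image_val_mem hE'
    rw [hcomp] at hmem
    obtain ⟨E'', hE'', hE''eq⟩ := hmem
    have hcl : closure (Subtype.val '' E') =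
        strictTransformSet π (closure (Subtype.val '' E)) E'' := by
      rw [closure_image_val_eq hS'c hE', hE''eq]
    have : (⟨closure (Subtype.val '' E'), isClosed_closure⟩ : Closeds X') =
        ⟨strictTransformSet π (closure (Subtype.val '' E)) E'',
          strictTransformSet.isClosed π _ E''⟩ :=
      Closeds.ext hcl
    rw [this]
    exact hregE E'' hE''.1 hE''.2
  · rw [← ncard_componentsIn_eq, ← ncard_componentsIn_eq]
    exact hcount

/-- `DeJong1996CodimThreeModification` from 3.5 (`DeJong1996SemiStablePairIsNormalForm`), the
two parts of Claim 4.27, the formal/étale equivalence (`DeJong1996FormalNormalCrossings`) and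
the projectivity of blow-ups. [cite: DeJong1996, 4.24–4.28, pp. 75–76] -/
theorem DeJong1996CodimThreeModification.of_isNormalForm_of_singularLocus_of_charts_of_formal
    (hN : DeJong1996SemiStablePairIsNormalForm.{u})
    (hC₁ : DeJong1996NormalFormPairBlowupSingularLocus.{u})
    (hC₂ : DeJong1996NormalFormPairBlowupCharts.{u}) (hF : DeJong1996FormalNormalCrossings.{u})
    (hP : BlowupProjectiveOverField.{u}) : DeJong1996CodimThreeModification.{u} :=
  DeJong1996CodimThreeModification.of_isNormalForm_of_blowup_of_formal hN
    (DeJong1996NormalFormPairBlowup.of_singularLocus_of_charts hC₁ hC₂) hF hP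

/-- `DeJong1996NormalFormPairResolution` (4.25–4.28) from the two parts of Claim 4.27, the
formal/étale equivalence, 2.4 (`DeJong1996NormalCrossingsBlowup`) and the projectivity of
blow-ups. [cite: DeJong1996, 4.25–4.28, pp. 75–76] -/
theorem DeJong1996NormalFormPairResolution.of_singularLocus_of_charts_of_formal_of_ncBlowup
    (hC₁ : DeJong1996NormalFormPairBlowupSingularLocus.{u})
    (hC₂ : DeJong1996NormalFormPairBlowupCharts.{u}) (hF : DeJong1996FormalNormalCrossings.{u})
    (hB : DeJong1996NormalCrossingsBlowup.{u}) (hP : BlowupProjectiveOverField.{u}) :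
    DeJong1996NormalFormPairResolution.{u} :=
  DeJong1996NormalFormPairResolution.of_blowup_of_formal_of_ncBlowup
    (DeJong1996NormalFormPairBlowup.of_singularLocus_of_charts hC₁ hC₂) hF hB hP

/-- `DeJong1996NormalFormPairBlowup` (Claim 4.27) from [C1] over the centre and the charts
[C2]; the description of `Sing(X')` off the exceptional locus and the count are proved.
[cite: DeJong1996, 4.26–4.27, pp. 75–76] -/
theorem DeJong1996NormalFormPairBlowup.of_overCentre_of_charts
    (hC₁ : DeJong1996NormalFormPairBlowupSingularLocusOverCentre.{u})
    (hC₂ : DeJong1996NormalFormPairBlowupCharts.{u}) : DeJong1996NormalFormPairBlowup.{u} :=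
  DeJong1996NormalFormPairBlowup.of_singularLocus_of_charts
    (DeJong1996NormalFormPairBlowupSingularLocus.of_overCentre hC₁) hC₂

/-- `DeJong1996CodimThreeModification` from 3.5 (`DeJong1996SemiStablePairIsNormalForm`), [C1]
over the centre, the charts [C2], the formal/étale equivalence and the projectivity of
blow-ups. [cite: DeJong1996, 4.24–4.28, pp. 75–76] -/
theorem DeJong1996CodimThreeModification.of_isNormalForm_of_overCentre_of_charts_of_formal
    (hN : DeJong1996SemiStablePairIsNormalForm.{u})
    (hC₁ : DeJong1996NormalFormPairBlowupSingularLocusOverCentre.{u})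
    (hC₂ : DeJong1996NormalFormPairBlowupCharts.{u}) (hF : DeJong1996FormalNormalCrossings.{u})
    (hP : BlowupProjectiveOverField.{u}) : DeJong1996CodimThreeModification.{u} :=
  DeJong1996CodimThreeModification.of_isNormalForm_of_singularLocus_of_charts_of_formal hN
    (DeJong1996NormalFormPairBlowupSingularLocus.of_overCentre hC₁) hC₂ hF hP

/-! ## Sanity of the cut -/

/-- Sanity: the bundled Claim gives back [C1]'s regularity for the components of `Sing(X')`, in
the bundled form, and the count (they are among its conclusions). [folklore] -/
theorem DeJong1996NormalFormPairBlowup.isRegular_subscheme_and_ncard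
    (H : DeJong1996NormalFormPairBlowup.{u}) {k : Type u} [Field k] [IsAlgClosed k]
    {X X' : Scheme.{u}} {f : X ⟶ Spec (.of k)} {Z : Set X} {d : ℕ}
    (h : DeJong1996.NormalFormPair f Z d)
    {E : Set ↥({x : X | ¬ IsRegularLocalRing (X.presheaf.stalk x)} : Set X)}
    (hE : E ∈ irreducibleComponents ↥({x : X | ¬ IsRegularLocalRing (X.presheaf.stalk x)} : Set X))
    {π : X' ⟶ X}
    (hπ : IsBlowup π (Scheme.IdealSheafData.vanishingIdeal
      ⟨closure (Subtype.val '' E), isClosed_closure⟩))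
    (hproj : Literature.AlgebraicGeometry.Motives.IsProjectiveOver (Over.mk (π ≫ f))) :
    (∀ E' ∈ irreducibleComponents
        ↥({x : X' | ¬ IsRegularLocalRing (X'.presheaf.stalk x)} : Set X'),
      Scheme.IsRegular (Scheme.IdealSheafData.vanishingIdeal
        ⟨closure (Subtype.val '' E'), isClosed_closure⟩).subscheme) ∧
      (irreducibleComponents
          ↥({x : X' | ¬ IsRegularLocalRing (X'.presheaf.stalk x)} : Set X')).ncard + 1 =
        (irreducibleComponents
          ↥({x : X | ¬ IsRegularLocalRing (X.presheaf.stalk x)} : Set X)).ncard :=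
  ⟨(H k X f Z d h E hE X' π hπ hproj).1.isRegular_subscheme, (H k X f Z d h E hE X' π hπ hproj).2⟩

/-- Sanity of the cut: [C1] gives back its part over the centre (restrict the printed set
equality to the points over `Ē`). [folklore] -/
theorem DeJong1996NormalFormPairBlowupSingularLocusOverCentre.of_singularLocus
    (H : DeJong1996NormalFormPairBlowupSingularLocus.{u}) :
    DeJong1996NormalFormPairBlowupSingularLocusOverCentre.{u} := by
  intro k _ _ X f Z d h E hE X' π hπ hproj
  obtain ⟨hsing, hreg⟩ := H k X f Z d h E hE X' π hπ hproj
  refine ⟨fun x' _ => ?_, hreg⟩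
  have hx := Set.ext_iff.mp hsing x'
  simp only [Set.mem_setOf_eq, Set.mem_iUnion, Set.mem_sdiff, Set.mem_singleton_iff,
    exists_prop] at hx
  rw [hx]
  exact ⟨fun ⟨E', ⟨hE', hne⟩, hx'⟩ => ⟨E', hE', hne, hx'⟩,
    fun ⟨E', hE', hne, hx'⟩ => ⟨E', ⟨hE', hne⟩, hx'⟩⟩

end Literature.AlgebraicGeometry.Resolution

end
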